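import Literature.MathematicalPhysics.QuantumFieldTheory.Balaban1983to89.B8Prop7PrintedRZdGF3P2HalfSpace

/-!
# `Balaban1983to89.B8Prop7PrintedRZdGF3P2HalfSpaceAllL` — THE P₇-CURRENCY NECESSITY CERTIFICATE AT EVERY BLOCK SIZE `L ≥ 3`: [Balaban1985RegularSpaces]
# Proposition 7 AS TYPED-PRINTED (`B8SectGH.Prop7PrintedR`, constant `2α₂` in (1.145)) is FALSE on NODE 00's edition-δ₂ P-carrier `zdGF3HP₂` with print's PINNED
# tower-wise axial map `toAxialTower`, at the LAWFUL (`IdxB8LawsB`) and ADMISSIBLE (`B8ConstraintBonds.DomainSeq`) half-space member `(T, {x₀ ≥ 0})` — `d = 4`, `𝔸 = ℂ`,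
# and now EVERY `L ≥ 3` (so in particular the record's odd `L ≥ 5`): the `L`-general re-run of r05's crossing-bond arithmetic `B8Ineq145Lineage` §5 (G-B8-01)

statement-level skeleton of published theorems with citation tags; proofs where landed; nothing here is a claim about the Yang–Mills mass gap

T. Bałaban, *Spaces of regular gauge field configurations on a lattice and gauge fixing conditions*, Commun. Math. Phys. **99** (1985) 75–102
`[Balaban1985RegularSpaces]` ("B8"; journal page = PDF page + 74): Prop. 7 (1.143)–(1.145) p. 100, (1.139)–(1.140) p. 100, (1.29)–(1.31) pp. 81–82, (1.35) p. 82,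
(1.3)–(1.6) p. 77, p. 77 (bond convention); cell GAPS G-B8-01 (the constant of (1.145) on the bonds crossing `∂Λ_j`).  [3] = `[Balaban1985Averaging]`, (76)–(77),
(82), (85)–(87), (90) pp. 29–31, (127) p. 37.

## WHY THIS FILE (cell `pub-ymgap`, HUMAN RULING D-0062 ∕ D-0149 ∕ D-0154; N05 = [B8]; width seat `pub-ymgap-dag-n05-w5` g0; piece handed by dag-n05-w2 g2 «n05-w5 take (i)»,
## bus 2026-08-28T05:08Z; located by dag-n05-d g11 WORD-4 (A) and by `B8Prop7PrintedRZdGF3P2HalfSpace`'s HONEST SCOPE)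

`B8Ineq145Lineage` (r05) refutes the display (1.145) on the lineage's concrete `ℤᵈ` carriers at `d = 4`, `L = 3` (`ineq145_fails_lineage`, `Lθ = (27∕28)α₂`, value
`2 sin((9∕8)α₂) > 2α₂`), and `B8Prop7PrintedRZdGF3P2HalfSpace` (n05-w2) transports that witness to NODE 00's δ₂ carrier ∕ pinned map ∕ index laws — again at `L = 3`.  The
records' families have ODD `L ≥ 5`, so the record-facing certificate needs the same arithmetic with `L` a variable.  Everything in r05's §§1–5 up to the closed forms
`norm_lhs145_crossing` (`2|sin(flatRatio d L·Lθ∕2)|`, `flatRatio d L = 1 + d(L−1)∕(2L)`) and `norm_rhs145`, and n05-w2's §1 (the member) ∕ §2 (`uTower = u8`), is ALREADY general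
in `(d, L)`; only the final numerical step and the transport fixed `L = 3`.  THIS FILE re-runs exactly those two joints with `L` a variable: at `d = 4` the crossing phase is
`flatRatio 4 L·(27∕56)·α₂ = (3 − 2∕L)(27∕56)·α₂ ∈ [(9∕8)α₂, (81∕56)α₂)` for `L ≥ 3` (monotone in `L`), so `2 sin(phase) > 2α₂` for `0 < α₂ ≤ 1∕4` (`Real.sin_gt_sub_cube`), and the
series-logarithm guard `d(L−1)|θ| = (27∕7)(1 − 1∕L)α₂ < ln 2` holds uniformly in `L` once `α₂ ≤ 1∕6` (the transport uses `α₂ ≤ 1∕16` anyway, for `mlogCfg_spec`).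

## WHAT IS PROVED (kernel, 0 sorry; theorems only)

* §1 (arithmetic, `d = 4`, `L` a variable) `flatRatio_four_bounds` (`7∕3 ≤ flatRatio 4 L < 3`, `L ≥ 3`) · `flat_witness_exceeds_allL` (`2α₂ < 2 sin(flatRatio 4 L·(27∕28)α₂∕2)`,
  `L ≥ 3`, `0 < α₂ ≤ 1∕4`) · `witness_small_allL` (`Lθ = (27∕28)α₂`, `α₂ ≤ 1∕6` ⇒ `θ > 0`, `4(L−1)|θ| < ln 2`, `L|θ| < ln 2`; any `L ≥ 1`) ·
  ★ `ineq145_fails_lineage_allL` (r05's `ineq145_fails_lineage` with `3 ↦ L`, every `L ≥ 3`: `2α₂ < |(U′U₀)‾¹_b − Ū₀¹_b|` on the crossing bond) ·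
  `eq145_fails_lineage_allL` (the displayed EQUALITY fails there too: the right member is `2 sin((27∕56)α₂) < 2α₂`).
* §2 (transport, `L` a variable) ★★ `not_prop7PrintedR_zdGF3HP₂_toAxialTower_halfspace_allL (L) (hL : 3 ≤ L) (hL1 : 1 ≤ L) (β) (len)`: `∃ i : ZdIdx 4 L`, lawful, admissible,
  `i.Ω 0 = univ`, `i.Ω = OmegaHS 0`, with `¬ B8SectGH.Prop7PrintedR (fun _ : Unit => zdGF3HP₂ ℂ L β len i) (fun _ => toAxialTower ℂ L β len hL1 i)`; `…_zdGF3P₂…_allL` twin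
  (`Iff.rfl` fields).  (The separate binder `hL1 : 1 ≤ L` is the proof the map `toAxialTower` carries; any proof term serves, by proof irrelevance.)  The `L = 3` instances are
  n05-w2's `not_prop7PrintedR_zdGF3HP₂_toAxialTower_halfspace` ∕ r05's `ineq145_fails_lineage` (not re-derived from these, kept as landed).

## HONEST SCOPE

A NEGATIVE certificate about a proof CURRENCY (the typed-printed constant `2α₂` of (1.145) for print's pinned map), at every `L ≥ 3`, by transport of r05's kernel witness
(G-B8-01: one block of accumulated axial phase across `∂Λ₁`, flat abelian scalar model `𝔸 = ℂ`, `U₀ = 1`, `U₁ ≡ e^{iθ}`); NO estimate of [Balaban1985RegularSpaces] is proved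
anew; it says nothing against the REPAIRED currency `B8Ineq145.Prop7RepairedC C` (which holds there: r05's `B8Prop7HalfSpace.prop7RepairedC_halfspace`, any `L ≥ 2`), i.e. the
paper downstream is unaffected (constants only).  The certificate is at the CARRIER ∕ MEMBER level: no `Stage3Params` ∕ Stage-13 record term is constructed here (a consumer
instantiates `L := θ.L`, odd `≥ 5 ≥ 3`, at its record).  Count-neutral helper keyed `stmt-QuantumFields-20542` (K1⁷); N05 NOT discharged; no count claim (the chair's single
count line is the only count); `T_η ↦ ℤᵈ`; one finite `𝕋⁴` programme at fixed `ε`, Bałaban AS PRINTED; the Yang–Mills mass gap (Clay) is NOT proved by any of this — R4 closes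
the conditional finite-`𝕋⁴` rung `BalabanLadder.UV` only; nothing continuum ∕ ℝ⁴ ∕ OS.  No `sorry`, no `def`, no `instance`, no `notation`.  Unit `pub-ymgap-dag-n05-w5` (g0),
2026-08-28.

RELATED, NOT DUPLICATED: `B8Ineq145Lineage` (r05: §§1–5 closed forms USED; its `L = 3` main theorems are the special case), `B8Ineq145` (`flatRatio`, `flatRatio_four`: the
first-order statement `flatRatio 4 L > 2`; here the exact inequality with the sine), `B8Prop7PrintedRZdGF3P2HalfSpace` (n05-w2: §1 member + §2 `uTower = u8` USED; §3 = the
`L = 3` case), `B8Prop7HalfSpace` (r05: the half-space geometry, `OmegaHS`), `B8Prop7TowerAxialZd3` ∕ `…Unitary` (n05-c: the pinned map, USED), `B8LeafModelZd3P2` (the carrier).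

[cite: Balaban1985RegularSpaces, Prop. 7 (1.143)–(1.145) p.100, (1.139)–(1.140) p.100, (1.29)–(1.31) pp.81–82, (1.35) p.82, (1.3)–(1.6) p.77, p.77; Balaban1985Averaging, (76)–(77) pp.29–30, (82) p.30, (85)–(87) p.31, (90) p.31, (127) p.37]
-/

noncomputable section

open NormedSpace Finset

namespace Literature.MathematicalPhysics.QuantumFieldTheory.Balaban1983to89.B8Prop7PrintedRZdGF3P2HalfSpaceAllL

open Complex (I)
open B7Prop1Explicit B7Prop1Local B7Prop2Explicit B7Eq92Concrete B7Eq84Concrete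
open B8Ineq130 (tlo thi tlo_apply thi_apply)
open B8Ineq132 (Under InAk covDerivFwd)
open B8Eq140Level (SideTouches)
open B8Eq143PlaqExpansion (pdiv)
open B8Eq146AExpansion (plaqCovDeriv plaqCovDeriv_eq_covDerivFwd)
open B8Eq184Proof (cfgExp)
open B8Lemma1NonAbelian (mulCfg)
open B8Thm4Concrete (mulCfg_eq_mul)
open B8IdxB8LawsB (IdxB8LawsB)
open B8ConstraintBonds (DomainSeq)
open B8LeafModelZd (ZdIdx)
open B8LeafModelZd3 (zdGF3 mlogCfg mlogCfg_spec)
open B8LeafModelZd3P (EndBlockIn)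
open B8LeafModelZd3P2 (zdGF3P₂ zdGF3HP₂)
open B8Prop7AdmittedFamily (cst cst_pos)
open B8Prop7TowerAxialZd3 (uTower toAxialTower toAxialTower_of_unitary)
open B8Prop7TowerAxialUnitary (uTower_facts)
open B8Ineq145 (flatRatio)
open B7Prop4GeneralLevels (logCovIter)
open B8Ineq145Lineage (eI u8 hyp139 hyp140_grad norm_lhs145_crossing norm_rhs145 Lam mem_Lam_zero mem_Lam_one)
open B8Prop7HalfSpace (OmegaHS omegaHS_zero omegaHS_one sideTouches_omegaHS_zero)
open B8Prop7PrintedRZdGF3P2HalfSpace (exists_halfspace_member_lawsB uTower_lam_eq_u8)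
open B9SupplySockB9P3ZdSocketBoundaryMode (cfgExp_mem_unitaryUnits)

-- `Site` alone could resolve to the torus sites of `Setup.lean`; re-export the `ℤ^d` sites of `B7Prop1Explicit`.
export B7Prop1Explicit (Site)

/-! ## §1 The arithmetic of the witness at general `L` -/

/-- `flatRatio 4 L = 3 − 2/L ∈ [7/3, 3)` for `L ≥ 3`. [folklore] -/
private theorem flatRatio_four_bounds (L : ℕ) (hL : 3 ≤ L) : 7 / 3 ≤ flatRatio 4 L ∧ flatRatio 4 L < 3 := by
  have hL' : (3 : ℝ) ≤ L := by exact_mod_cast hL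
  have hLpos : (0 : ℝ) < L := by linarith
  unfold flatRatio
  have hlo : 4 / 3 ≤ (4 : ℕ) * ((L : ℝ) - 1) / (2 * L) := by
    rw [le_div_iff₀ (by positivity)]
    push_cast
    nlinarith
  have hhi : (4 : ℕ) * ((L : ℝ) - 1) / (2 * L) < 2 := by
    rw [div_lt_iff₀ (by positivity)]
    push_cast
    nlinarith
  constructor <;> linarith

/-- **The witness beats the printed `2α₂` at every `L ≥ 3`** (`d = 4`, `Lθ = (27/28)α₂`): `2 sin(flatRatio 4 L·(27/28)α₂/2) > 2α₂`
for `0 < α₂ ≤ 1/4` (the phase `(3 − 2/L)(27/56)α₂` is at least `(9/8)α₂`) — the arithmetic core of the located failure G-B8-01 of the printed constant of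
(1.145) on the crossing bonds, `L`-uniform form of `B8Ineq145.flat_witness_exceeds`. [cite: Balaban1985RegularSpaces, Prop. 7 (1.145) p.100, (1.31) p.82 (located failure G-B8-01, arithmetic core)] -/
theorem flat_witness_exceeds_allL (L : ℕ) (hL : 3 ≤ L) (α₂ : ℝ) (h0 : 0 < α₂) (h1 : α₂ ≤ 1 / 4) :
    2 * α₂ < 2 * Real.sin (flatRatio 4 L * ((27 / 28) * α₂) / 2) := by
  obtain ⟨hlo, hhi⟩ := flatRatio_four_bounds L hL
  have harg : flatRatio 4 L * ((27 / 28) * α₂) / 2 = (flatRatio 4 L * (27 / 56)) * α₂ := by ring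
  rw [harg]
  set r : ℝ := flatRatio 4 L * (27 / 56) with hr
  have hr_lo : 9 / 8 ≤ r := by rw [hr]; linarith
  have hr_hi : r ≤ 3 / 2 := by rw [hr]; linarith
  have hr0 : 0 ≤ r := by linarith
  have hx : 0 < r * α₂ := by positivity
  have hs := Real.sin_gt_sub_cube hx
  have hr3 : r ^ 3 ≤ 27 / 8 := by nlinarith [mul_nonneg hr0 hr0, hr_hi, hr0]
  have hsq : α₂ ^ 2 ≤ 1 / 16 := by nlinarith
  have key : (r * α₂) ^ 3 / 6 ≤ 27 / 768 * α₂ := by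
    have h' : (r * α₂) ^ 3 / 6 = (r ^ 3 * α₂ ^ 2 / 6) * α₂ := by ring
    rw [h']
    apply mul_le_mul_of_nonneg_right _ h0.le
    have : r ^ 3 * α₂ ^ 2 ≤ 27 / 8 * (1 / 16) :=
      mul_le_mul hr3 hsq (by positivity) (by positivity)
    linarith
  have hrα : 9 / 8 * α₂ ≤ r * α₂ := mul_le_mul_of_nonneg_right hr_lo h0.le
  linarith [hs, key, hrα, h0]

/-- Bookkeeping of the witness at general `L ≥ 1`: with `Lθ = (27/28)α₂`, `0 < α₂ ≤ 1/6`, every series logarithm used is inside its disc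
(`4(L−1)|θ| < ln 2`, `L|θ| < ln 2`) and `θ > 0`. [folklore] -/
private theorem witness_small_allL {L : ℕ} (hL : 1 ≤ L) {α₂ θ : ℝ} (h0 : 0 < α₂) (h1 : α₂ ≤ 1 / 6)
    (hθ : (L : ℝ) * θ = 27 / 28 * α₂) :
    0 < θ ∧ ((4 : ℕ) : ℝ) * (((L : ℕ) : ℝ) - 1) * |θ| < Real.log 2 ∧ ((L : ℕ) : ℝ) * |θ| < Real.log 2 := by
  have hL' : (1 : ℝ) ≤ L := by exact_mod_cast hL
  have hLpos : (0 : ℝ) < L := by linarith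
  have hθpos : 0 < θ := by
    have h' : (L : ℝ) * 0 < (L : ℝ) * θ := by rw [mul_zero, hθ]; positivity
    exact lt_of_mul_lt_mul_left h' hLpos.le
  have hlog := Real.log_two_gt_d9
  refine ⟨hθpos, ?_, ?_⟩
  · rw [abs_of_pos hθpos]
    push_cast
    have : (4 : ℝ) * ((L : ℝ) - 1) * θ ≤ 4 * ((L : ℝ) * θ) := by nlinarith
    rw [hθ] at this
    linarith
  · rw [abs_of_pos hθpos]; linarith

/-- **THE INEQUALITY OF (1.145) FAILS ON THE LINEAGE CARRIERS AT EVERY `L ≥ 3`** (`d = 4`, `k = 1`, half-space geometry, `U₀ = 1`,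
`U₁ ≡ e^{iθ}`, `Lθ = (27/28)α₂`, `0 < α₂ ≤ 1/6`): on every crossing bond `b = ⟨y, y + e_{i₀}⟩`, `y_{i₀} = −1`,
`2α₂ < |(U′U₀)‾¹_b − Ū₀¹_b|`. [cite: Balaban1985RegularSpaces, Prop. 7 (1.145) p.100] -/
theorem ineq145_fails_lineage_allL {L : ℕ} (hL : 3 ≤ L) (hL1 : 1 ≤ L) (i₀ : Fin 4) {α₂ θ : ℝ} (h0 : 0 < α₂)
    (h1 : α₂ ≤ 1 / 6) (hθ : (L : ℝ) * θ = 27 / 28 * α₂) (y : Site 4) (hy : y i₀ = -1) :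
    2 * α₂ < ‖((avgIter L (mgauge 1 (u8 L hL1 i₀ 1 (B8Ineq145Lineage.cst (eI θ))) (B8Ineq145Lineage.cst (eI θ))
          * (1 : Site 4 → Fin 4 → ℂˣ)) 1 y i₀ : ℂˣ) : ℂ) - ((avgIter L (1 : Site 4 → Fin 4 → ℂˣ) 1 y i₀ : ℂˣ) : ℂ)‖ := by
  obtain ⟨-, h8, -⟩ := witness_small_allL hL1 h0 h1 hθ
  rw [norm_lhs145_crossing L hL1 i₀ θ h8 y hy]
  have hcast : ((L : ℕ) : ℝ) * θ = 27 / 28 * α₂ := hθ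
  rw [hcast]
  calc 2 * α₂ < 2 * Real.sin (flatRatio 4 L * (27 / 28 * α₂) / 2) :=
        flat_witness_exceeds_allL L hL α₂ h0 (by linarith)
    _ ≤ 2 * |Real.sin (flatRatio 4 L * (27 / 28 * α₂) / 2)| := by gcongr; exact le_abs_self _


/-- **The right member of (1.145) stays below `2α₂`** at the witness (every `L ≥ 1`): `|exp iQ₁(U₀, ηA)_b − 1| = 2|sin(Lθ/2)| = 2 sin((27/56)α₂) < 2α₂` —
so the displayed EQUALITY of (1.145) fails on the crossing bond together with the inequality. [cite: Balaban1985RegularSpaces, Prop. 7 (1.145) p.100, (1.31) p.82] -/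
theorem eq145_fails_lineage_allL {L : ℕ} (hL : 3 ≤ L) (hL1 : 1 ≤ L) (i₀ : Fin 4) {α₂ θ : ℝ} (h0 : 0 < α₂) (h1 : α₂ ≤ 1 / 6)
    (hθ : (L : ℝ) * θ = 27 / 28 * α₂) (y : Site 4) (hy : y i₀ = -1) :
    ‖((avgIter L (mgauge 1 (u8 L hL1 i₀ 1 (B8Ineq145Lineage.cst (eI θ))) (B8Ineq145Lineage.cst (eI θ))
          * (1 : Site 4 → Fin 4 → ℂˣ)) 1 y i₀ : ℂˣ) : ℂ) - ((avgIter L (1 : Site 4 → Fin 4 → ℂˣ) 1 y i₀ : ℂˣ) : ℂ)‖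
      ≠ ‖exp (logCovIter L (1 : Site 4 → Fin 4 → ℂˣ) (B8Ineq145Lineage.cst (I * (θ : ℂ))) 1 y i₀) - 1‖ := by
  obtain ⟨hθpos, -, h3⟩ := witness_small_allL hL1 h0 h1 hθ
  have hlhs := ineq145_fails_lineage_allL hL hL1 i₀ h0 h1 hθ y hy
  have hrhs : ‖exp (logCovIter L (1 : Site 4 → Fin 4 → ℂˣ) (B8Ineq145Lineage.cst (I * (θ : ℂ))) 1 y i₀) - 1‖ < 2 * α₂ := by
    rw [norm_rhs145 L θ h3 y i₀]
    have hx : 0 < ((L : ℕ) : ℝ) * θ / 2 := by positivity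
    have hxπ : ((L : ℕ) : ℝ) * θ / 2 < Real.pi := by
      have := Real.pi_gt_three
      have h' : ((L : ℕ) : ℝ) * θ = 27 / 28 * α₂ := hθ
      rw [h']; linarith
    rw [abs_of_pos (Real.sin_pos_of_pos_of_lt_pi hx hxπ)]
    have hs := Real.sin_lt hx
    have h' : ((L : ℕ) : ℝ) * θ = 27 / 28 * α₂ := hθ
    rw [h'] at hs ⊢
    linarith
  exact fun h => by linarith [h ▸ hlhs]

/-! ## §2 The typed-printed Proposition 7 FAILS on the δ₂ carrier with the pinned map at the half-space member, EVERY `L ≥ 3` -/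

section Printed

variable {L : ℕ}

/-- The witness exponent at general `L`: `e^{iη·A} = e^{iθ}` bondwise for `η = 1∕L`, `A ≡ Lθ`. [folklore] -/
private theorem cfgExp_inv_eq (hL1 : 1 ≤ L) (θ : ℝ) :
    cfgExp ((L : ℝ)⁻¹) (fun (_ : Site 4) (_ : Fin 4) => ((((L : ℝ) * θ : ℝ)) : ℂ)) = B8Ineq145Lineage.cst (eI θ) := by
  funext x κ
  show expUnit (I • (((L : ℝ)⁻¹) • ((((L : ℝ) * θ : ℝ)) : ℂ))) = expUnit (I * (θ : ℂ))
  have hL0' : (L : ℂ) ≠ 0 := by exact_mod_cast (show (L : ℕ) ≠ 0 by omega)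
  congr 1
  rw [smul_eq_mul, Complex.real_smul]
  push_cast
  congr 1
  exact inv_mul_cancel_left₀ hL0' _

/-- ★★ **THE TYPED-PRINTED PROPOSITION 7 (`B8SectGH.Prop7PrintedR`, constant `2α₂`) IS FALSE ON NODE 00's δ₂ CARRIER `zdGF3HP₂` WITH PRINT'S PINNED TOWER-WISE MAP
`toAxialTower`, AT THE LAWFUL ADMISSIBLE HALF-SPACE MEMBER, FOR EVERY BLOCK SIZE `L ≥ 3`** (`d = 4`, `𝔸 = ℂ`, any `β`, `len`; in particular at the record's odd
`L ≥ 5`): for every threshold `c > 0` the data `α₀ = α₂ = min{c, 1∕16, c(4,L)}`, `U₀ = 1`, `U₁ = e^{iηA}`, `η = 1∕L`, `A ≡ Lθ`, `Lθ = (27∕28)α₂` satisfy (1.33) `InA` and the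
carrier's honest (1.140) `C140` (the canonical `mlogCfg` is `A`; flat background), the map is in its unitary regime (`uTower_facts`, so `U′ = U₁^{uTower}` with `uTower = u8`),
and the conclusion (1.145) ↦ `avgClose (2α₂)` in the ONE-END-POINT class fails at the level-`1` bond `⟨y, y + e₀⟩`, `y₀ = −1` (`B¹(y + e₀) ⊂ Ω₁`): `ineq145_fails_lineage_allL`
gives `2α₂ <` the left member (the crossing phase `(3 − 2∕L)(27∕56)α₂ ≥ (9∕8)α₂`).  The `L = 3` instance is n05-w2's `B8Prop7PrintedRZdGF3P2HalfSpace.not_prop7PrintedR_zdGF3HP₂_toAxialTower_halfspace`.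
[cite: Balaban1985RegularSpaces, Prop. 7 (1.143)–(1.145) p.100, (1.35) p.82, p.77, (1.3)–(1.4) p.77; Balaban1985Averaging, (76)–(77) pp.29–30, (87) p.31] -/
theorem not_prop7PrintedR_zdGF3HP₂_toAxialTower_halfspace_allL (L : ℕ) (hL : 3 ≤ L) (hL1 : 1 ≤ L) (β : ℝ) (len : Site 4 → ℝ) :
    ∃ i : ZdIdx 4 L, IdxB8LawsB L i ∧ DomainSeq L i.Ω ∧ i.Ω 0 = Set.univ ∧ i.Ω = OmegaHS (0 : Fin 4) ∧
      ¬ B8SectGH.Prop7PrintedR (fun _ : Unit => zdGF3HP₂ ℂ L β len i) (fun _ => toAxialTower ℂ L β len hL1 i) := by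
  have hL2 : 2 ≤ L := le_trans (by norm_num) hL
  have hLr : (1 : ℝ) ≤ L := by exact_mod_cast hL1
  have hL0 : (L : ℝ) ≠ 0 := by linarith
  have hLpos : (0 : ℝ) < L := by linarith
  obtain ⟨i, hik, hiη, hΩ, hΛ, -, hlaws, hadm⟩ := exists_halfspace_member_lawsB (d := 4) hL1 (0 : Fin 4)
  have hΩ0 : i.Ω 0 = Set.univ := by rw [hΩ]; exact omegaHS_zero 0
  refine ⟨i, hlaws, hadm, hΩ0, hΩ, ?_⟩
  rintro ⟨c, hc, H⟩
  -- the smallness parameters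
  set α₂ : ℝ := min c (min (1 / 16) (cst 4 L)) with hα₂
  have hcst : 0 < cst 4 L := cst_pos (by norm_num) L hL1
  have h0 : 0 < α₂ := lt_min hc (lt_min (by norm_num) hcst)
  have hc2 : α₂ ≤ c := min_le_left _ _
  have h16 : α₂ ≤ 1 / 16 := (min_le_right _ _).trans (min_le_left _ _)
  have hcs : α₂ ≤ cst 4 L := (min_le_right _ _).trans (min_le_right _ _)
  have h6 : α₂ ≤ 1 / 6 := h16.trans (by norm_num)
  set θ : ℝ := 27 / 28 * α₂ / L with hθdef
  have hθ : (L : ℝ) * θ = 27 / 28 * α₂ := by rw [hθdef, mul_div_assoc', mul_div_cancel_left₀ _ hL0]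
  have hLθpos : 0 < (L : ℝ) * θ := by rw [hθ]; positivity
  have hθpos : 0 < θ := by rw [hθdef]; positivity
  -- the data on the member: `η = 1∕L`, `U₀ = 1`, `U₁ = e^{iηA}`, `A ≡ Lθ`
  have hη : i.η = (L : ℝ)⁻¹ := hiη
  let A : Site 4 → Fin 4 → ℂ := fun _ _ => ((((L : ℝ) * θ : ℝ)) : ℂ)
  have hAh : ∀ (y : Site 4) (κ : Fin 4), IsSelfAdjoint (A y κ) := fun _ _ => by
    show star ((((L : ℝ) * θ : ℝ)) : ℂ) = (((L : ℝ) * θ : ℝ) : ℂ)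
    rw [Complex.star_def, Complex.conj_ofReal]
  have hnormA : ∀ (y : Site 4) (κ : Fin 4), ‖A y κ‖ = (L : ℝ) * θ := fun _ _ => by
    show ‖((((L : ℝ) * θ : ℝ)) : ℂ)‖ = (L : ℝ) * θ
    rw [Complex.norm_real, Real.norm_eq_abs, abs_of_pos hLθpos]
  let U₀ : (zdGF3HP₂ ℂ L β len i).Cfg := ⟨1, fun _ _ => (unitaryUnits ℂ).one_mem⟩
  let U₁ : {U : Site 4 → Fin 4 → ℂˣ // ∀ x κ, U x κ ∈ unitaryUnits ℂ} :=
    ⟨cfgExp i.η A, fun x κ => cfgExp_mem_unitaryUnits i.η hAh x κ⟩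
  let P : (zdGF3HP₂ ℂ L β len i).Pert := (U₀, U₁)
  have hU₁ : (P.2.1 : Site 4 → Fin 4 → ℂˣ) = B8Ineq145Lineage.cst (eI θ) := by
    show cfgExp i.η A = _; rw [hη]; exact cfgExp_inv_eq hL1 θ
  -- (1.33) for `U₀ = 1`
  have hInA : (zdGF3 ℂ L β len i).InA α₂ U₀ := by
    show InAk L i.k i.η α₂ i.Ω (1 : Site 4 → Fin 4 → ℂˣ)
    exact hyp139 L hL1 i.k i.hη h0 i.Ω
  -- (1.140) in the carrier's honest body: the canonical masked logarithm is `A`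
  have hall : ∀ (y : Site 4) (τ : Fin 4), SideTouches (i.Ω 0) y τ := fun y τ => by
    rw [hΩ]; exact sideTouches_omegaHS_zero (by norm_num) 0 y τ
  -- the two weights `(L^j η)⁻¹`, `j = 0, 1`, at `η = 1/L`
  have hw0 : ((L : ℝ) ^ 0 * i.η)⁻¹ = L := by rw [hη, pow_zero, one_mul, inv_inv]
  have hw1 : ((L : ℝ) ^ 1 * i.η)⁻¹ = 1 := by rw [hη, pow_one, mul_inv_cancel₀ hL0, inv_one]
  have hv0 : (L : ℝ) ^ 0 * i.η = (L : ℝ)⁻¹ := by rw [hη, pow_zero, one_mul]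
  have hv1 : (L : ℝ) ^ 1 * i.η = 1 := by rw [hη, pow_one, mul_inv_cancel₀ hL0]
  have hWA : ∀ j, j ≤ i.k → ∀ (y : Site 4) (τ : Fin 4), SideTouches (i.Ω j) y τ →
      P.2.1 y τ = cfgExp i.η A y τ ∧ ‖A y τ‖ ≤ α₂ * ((L : ℝ) ^ j * i.η)⁻¹ := by
    intro j hj y τ _
    refine ⟨rfl, ?_⟩
    rw [hik] at hj
    rw [hnormA y τ]
    interval_cases j
    · rw [hw0, hθ]; nlinarith
    · rw [hw1, hθ]; linarith
  obtain ⟨hmsa, hmeq, -⟩ := mlogCfg_spec (W := P.2.1) i.hη hL1 i.k (1 : Site 4 → Fin 4 → ℂˣ) P.2.2 h0.le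
    (by linarith) i.Ω hWA
  have hmA : mlogCfg i.k i.η i.Ω P.2.1 = A := by
    funext y τ
    exact (hmeq 0 (Nat.zero_le _) y τ (hall y τ)).1
  have hgrad1 : ∀ (κ τ : Fin 4) (y : Site 4), covDerivFwd i.η (1 : Site 4 → Fin 4 → ℂˣ) κ (fun z => A z τ) y = 0 :=
    fun κ τ y => hyp140_grad i.η _ κ y
  have hplaq1 : plaqCovDeriv i.η (1 : Site 4 → Fin 4 → ℂˣ) A = fun _ _ _ => 0 := by
    funext μ ν x
    rw [plaqCovDeriv_eq_covDerivFwd, hgrad1 μ ν x, hgrad1 ν μ x, sub_zero]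
  have hdiv1 : ∀ (μ : Fin 4) (y : Site 4), pdiv i.η (1 : Site 4 → Fin 4 → ℂˣ) (plaqCovDeriv i.η 1 A) μ y = 0 := by
    intro μ y
    rw [hplaq1]
    simp [pdiv, B8Ineq132.covDeriv, B7Eq78Linearization.conjR_apply]
  have hgrad : ∀ (κ τ : Fin 4) (y : Site 4), covDerivFwd i.η U₀.1 κ (fun z => A z τ) y = 0 := hgrad1
  have hdiv : ∀ (μ : Fin 4) (y : Site 4), pdiv i.η U₀.1 (plaqCovDeriv i.η U₀.1 A) μ y = 0 := hdiv1
  have h140 : (zdGF3 ℂ L β len i).C140 α₂ U₀ P := by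
    intro j hj y τ hst
    rw [hmA]
    rw [hik] at hj
    refine ⟨rfl, hAh y τ, ?_, fun κ => ?_, ?_⟩
    · rw [hnormA y τ]
      interval_cases j
      · rw [hv0, inv_mul_cancel_left₀ hL0 θ]
        have hθle : θ ≤ 27 / 28 * α₂ := by
          rw [← hθ]; nlinarith
        linarith
      · rw [hv1, one_mul, hθ]; linarith
    · rw [hgrad κ τ y, norm_zero, mul_zero]; exact h0
    · rw [hdiv τ y, norm_zero, mul_zero]; exact h0
  -- the map is in its unitary regime: `U′ = U₁^{uTower}`, `uTower = u8`
  have hunit := fun x => (uTower_facts (𝔸 := ℂ) (β := β) (len := len) (by norm_num : 2 ≤ 4) hL2 i hΩ0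
    h0 hcs h0 hcs U₀ P hInA h140 x).1
  have hTA := toAxialTower_of_unitary (𝔸 := ℂ) (β := β) (len := len) hL1 i U₀ P hunit
  -- the conclusion (1.145) at the crossing bond
  obtain ⟨-, havg⟩ := H () α₂ α₂ h0 hc2 h0 hc2 U₀ P hInA h140
  let y : Site 4 := fun j => if j = 0 then -1 else 0
  have hy : y 0 = -1 := by simp [y]
  have hend : EndBlockIn L (i.Ω 1) 1 y 0 := by
    refine Or.inr fun x hx => ?_
    rw [hΩ, omegaHS_one]
    show 0 ≤ x 0
    have h1 := (hx 0).1
    rw [tlo_apply, pow_one] at h1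
    simp only [Pi.add_apply, e_apply, if_true, y] at h1
    simpa using h1
  have hle := havg 1 (by rw [hik]) y 0 hend
  dsimp only at hle
  rw [hTA] at hle
  -- rewrite the member's data into r05's letters
  have hLHS : (avgIter L (mulCfg (mgauge U₀.1 (uTower L hL1 i.k (i.Λs i.k) U₀.1 P.2.1) P.2.1) U₀.1) 1 y 0 : ℂ)
      = (avgIter L (mgauge 1 (u8 L hL1 (0 : Fin 4) 1 (B8Ineq145Lineage.cst (eI θ))) (B8Ineq145Lineage.cst (eI θ))
          * (1 : Site 4 → Fin 4 → ℂˣ)) 1 y 0 : ℂ) := by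
    rw [mulCfg_eq_mul, hik, hΛ, uTower_lam_eq_u8, hU₁]
  have hlt := ineq145_fails_lineage_allL hL hL1 (0 : Fin 4) h0 h6 hθ y hy
  have hle' : ‖(avgIter L (mulCfg (mgauge U₀.1 (uTower L hL1 i.k (i.Λs i.k) U₀.1 P.2.1) P.2.1) U₀.1) 1 y 0 : ℂ)
      - (avgIter L U₀.1 1 y 0 : ℂ)‖ ≤ 2 * α₂ := hle
  rw [hLHS] at hle'
  exact lt_irrefl _ (hle'.trans_lt hlt)

/-- The same on the `zdGF3P₂` face (Proposition 7 reads no source; the fields it reads are `rfl`-equal), every `L ≥ 3`.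
[cite: Balaban1985RegularSpaces, Prop. 7 (1.144)–(1.145) p.100] -/
theorem not_prop7PrintedR_zdGF3P₂_toAxialTower_halfspace_allL (L : ℕ) (hL : 3 ≤ L) (hL1 : 1 ≤ L) (β : ℝ) (len : Site 4 → ℝ) :
    ∃ i : ZdIdx 4 L, IdxB8LawsB L i ∧ DomainSeq L i.Ω ∧ i.Ω 0 = Set.univ ∧ i.Ω = OmegaHS (0 : Fin 4) ∧
      ¬ B8SectGH.Prop7PrintedR (fun _ : Unit => zdGF3P₂ ℂ L β len i) (fun _ => toAxialTower ℂ L β len hL1 i) :=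
  not_prop7PrintedR_zdGF3HP₂_toAxialTower_halfspace_allL L hL hL1 β len

end Printed

end Literature.MathematicalPhysics.QuantumFieldTheory.Balaban1983to89.B8Prop7PrintedRZdGF3P2HalfSpaceAllL

end
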